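import Literature.Barriers.CriticalPhenomena.LongRangeTrivialityOnZ3Field
import Literature.Probability.LatticeModels.IsingPeierls
import Literature.Probability.LatticeModels.OnsagerYang
import Literature.Probability.LatticeModels.ThermodynamicLimitProofs
import Literature.Probability.LatticeModels.PositiveFieldUniqueness

/-!
# Long-range ferromagnets on `ℤ^d`, `d ≥ 2`, are ordered at low temperature: `m*(β) ≥ ½` for
# `βC₀ ≥ 4` when `J_{x,y} ≥ C₀` on nearest neighbours (Peierls' bound through Griffiths' 1964
# convexity argument)

Sibling of `Literature/Barriers/CriticalPhenomena/LongRangeTrivialityOnZ3.lean` (barrier catalogue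
D-0021, sub-problem `Ising3DConformalLimit`); third file serving the discharge of
`Literature.Barriers.CriticalPhenomena.panis_criticalBeta_pos` (Panis 2023, §1.2.1: "In dimensions
`d > 1`, the model exhibits a phase transition … `β_c := inf{β > 0, m*(β) > 0} ∈ (0,∞)` … Peierls'
celebrated argument yields the bound `β_c < ∞`", p. 6 of arXiv:2309.05797). Since the tree's
`β_c` is an `sInf` (`= 0` on the empty set), `0 < β_c` needs a `β > 0` with `m*(β) > 0`, where
`m*(β) = lim_{h→0⁺} lim_L ⟨σ₀⟩_{Λ_L,J,h,β}` is defined through the **free** finite-volume states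
in a positive field (`LongRangeIsing.magnetization`), while Peierls' estimate — the tree theorem
`Literature.Probability.LatticeModels.half_le_isingCorr_plus_box_zero` (`IsingPeierls`):
`⟨σ₀⟩⁺_{Λ_L;β',0} ≥ ½` for the nearest-neighbour model, `β' ≥ 4`, `d ≥ 2` — concerns the **plus**
state at zero field. The identification `lim_{h↓0}⟨σ₀⟩_{β,h} = ⟨σ₀⟩⁺_{β,0}` (Friedli–Velenik
Prop. 3.29 / Lebowitz) is not in the tree; instead we follow the thermodynamic route of
R. B. Griffiths, *Peierls proof of spontaneous magnetization in a two-dimensional Ising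
ferromagnet*, Phys. Rev. 136 (1964) A437 (`m*` as `lim_{h→0⁺}∂f/∂h`), which needs only convexity
of `log Z` in the field and the independence of the pressure from the boundary condition:

for `Λ = Λ_L`, `t = βh = β'h' > 0`, `β' = βC₀ ≥ 4`, and the nearest-neighbour comparison
interaction `J' = C₀ 𝟙{|x-y|₁ = 1} = C₀ 1_{x∼y} ≤ J` (`nnCoupling` of the barrier file, `nnCoupling_eq_ite`),

* `t · |Λ|/2 ≤ t ∑_{x∈Λ} ⟨σ_x⟩⁺_{Λ;β',0}` (Peierls at every site: `⟨σ_x⟩⁺_{Λ_L(0)} ≥ ⟨σ_x⟩⁺_{Λ_{L+|x|}(x)} = ⟨σ₀⟩⁺_{Λ_{L+|x|}} ≥ ½`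
  by the antitonicity of `⟨·⟩⁺` in the volume and translation covariance — tree theorems
  `isingCorr_plus_le_of_subset`, `isingCorr_plus_map_shift`; `half_le_isingCorr_plus_box`);
* `t ∑_x ⟨σ_x⟩⁺_{Λ;β',0} ≤ log Z⁺_Λ(h') - log Z⁺_Λ(0)` (Jensen: `Z⁺(h')/Z⁺(0) = ⟨e^{tM}⟩⁺_0 ≥ e^{t⟨M⟩⁺_0}`,
  `M = ∑_{x∈Λ}σ_x`; `sum_mul_div_le_log_sub_log`, `mul_sum_isingCorr_plus_le_log_sub`);
* `|log Z⁺_Λ(·) - log Z_{Λ,J',·}| ≤ β' |∂ᵉΛ|` (the plus and the free = pair Hamiltonians differ by the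
  boundary bonds; `sum_sum_nnCoupling_eq_two_mul_sum_edgesIn`, `abs_energy_plus_sub_pair_le`, `log_isingZ_le_and_le`);
* `log Z_{Λ,J',h} - log Z_{Λ,J',0} ≤ t ∑_x ⟨σ_x⟩_{Λ,J',h,β}` (Jensen again, `log_pairZ_sub_le`);
* `⟨σ_x⟩_{Λ,J',h,β} ≤ ⟨σ_x⟩_{Λ,J,h,β} ≤ ⟨σ_x⟩_{J,h,β} = ⟨σ₀⟩_{J,h,β}` (Griffiths' comparison, monotone
  volume limit and translation invariance, `LongRangeTrivialityOnZ3Field`);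

whence `½ ≤ ⟨σ₀⟩_{J,h,β} + 4β'|∂ᵉΛ_L|/(t|Λ_L|)` for every `L`, and `|∂ᵉΛ_L|/|Λ_L| → 0` (van Hove;
the tree's `eventually_card_edgeBoundary_box_le` of `PositiveFieldUniqueness`, which runs the same
boundary-comparison scheme for the free/plus one-point functions of the nearest-neighbour model):
`⟨σ₀⟩_{J,h,β} ≥ ½` for all `h > 0`
(`half_le_state_spinAt`) and `m*(β) ≥ ½` (`half_le_magnetization`).

## References

* R. Panis, arXiv:2309.05797 (2023) = Ann. Probab. 54 (2026), §1.2.1 (`m*`, `β_c ∈ (0,∞)`, Peierls)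
  [Panis2023Triviality] (held; read pp. 5–6).
* R. Peierls, Proc. Camb. Phil. Soc. 32 (1936) 477–481 [Peierls1936]; R. B. Griffiths, Phys. Rev.
  136 (1964) A437–A439 (the thermodynamic form of Peierls' theorem).
* S. Friedli, Y. Velenik, *Statistical Mechanics of Lattice Systems*, CUP (2017), Thm. 3.25 (ii),
  §3.2.1 (pressure independent of the boundary condition), Exercise 3.12, Thm. 3.17 [FriedliVelenik2017].
-/

noncomputable section

namespace Literature.Barriers.CriticalPhenomena

open Literature.Probability.LatticeModels Literature.Probability.Percolation Filter Topology Finset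
open scoped symmDiff

namespace LongRangeIsing

variable {d : ℕ}

/-! ### Two elementary inequalities: Jensen for `log ∑ w e^{g}`, and comparison of `log ∑ e^{E}` -/

section Elementary

variable {Ω : Type*} [Fintype Ω] [Nonempty Ω]

/-- **Jensen's inequality for the free energy**: for positive weights `w` and any `g`,
`(∑ w g)/(∑ w) ≤ log(∑ w e^{g}) - log(∑ w)` (convexity of `exp`; the step
`log Z(h) - log Z(0) = log⟨e^{hM}⟩₀ ≥ h⟨M⟩₀` of Griffiths 1964). [folklore] -/
theorem sum_mul_div_le_log_sub_log (w g : Ω → ℝ) (hw : ∀ ω, 0 < w ω) :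
    (∑ ω, w ω * g ω) / ∑ ω, w ω ≤ Real.log (∑ ω, w ω * Real.exp (g ω)) - Real.log (∑ ω, w ω) := by
  have hW : 0 < ∑ ω, w ω := Finset.sum_pos (fun ω _ => hw ω) Finset.univ_nonempty
  have hWexp : 0 < ∑ ω, w ω * Real.exp (g ω) :=
    Finset.sum_pos (fun ω _ => mul_pos (hw ω) (Real.exp_pos _)) Finset.univ_nonempty
  have hJ := ConvexOn.map_sum_le convexOn_exp (t := univ) (w := fun ω => w ω / ∑ ω', w ω') (p := g)
    (fun ω _ => (div_pos (hw ω) hW).le) (by rw [← Finset.sum_div, div_self hW.ne']) (fun ω _ => Set.mem_univ _)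
  simp only [smul_eq_mul] at hJ
  have h1 : ∑ ω, w ω / (∑ ω', w ω') * g ω = (∑ ω, w ω * g ω) / ∑ ω, w ω := by
    rw [Finset.sum_div]
    exact Finset.sum_congr rfl fun ω _ => by ring
  have h2 : ∑ ω, w ω / (∑ ω', w ω') * Real.exp (g ω) = (∑ ω, w ω * Real.exp (g ω)) / ∑ ω, w ω := by
    rw [Finset.sum_div]
    exact Finset.sum_congr rfl fun ω _ => by ring
  rw [h1, h2] at hJ
  rw [← Real.log_div hWexp.ne' hW.ne', ← Real.exp_le_exp, Real.exp_log (div_pos hWexp hW)]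
  exact hJ

omit [Nonempty Ω] in
/-- If `E₁ ≤ E₂ + D` pointwise then `log ∑ e^{E₁} ≤ log ∑ e^{E₂} + D`. [folklore] -/
theorem log_sum_exp_le_of_le [Nonempty Ω] {E₁ E₂ : Ω → ℝ} {D : ℝ} (h : ∀ ω, E₁ ω ≤ E₂ ω + D) :
    Real.log (∑ ω, Real.exp (E₁ ω)) ≤ Real.log (∑ ω, Real.exp (E₂ ω)) + D := by
  have hpos : ∀ E : Ω → ℝ, 0 < ∑ ω, Real.exp (E ω) := fun E =>
    Finset.sum_pos (fun ω _ => Real.exp_pos _) Finset.univ_nonempty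
  have h1 : ∑ ω, Real.exp (E₁ ω) ≤ Real.exp D * ∑ ω, Real.exp (E₂ ω) := by
    rw [Finset.mul_sum]
    refine Finset.sum_le_sum fun ω _ => ?_
    rw [← Real.exp_add, Real.exp_le_exp, add_comm]
    exact h ω
  calc Real.log (∑ ω, Real.exp (E₁ ω)) ≤ Real.log (Real.exp D * ∑ ω, Real.exp (E₂ ω)) :=
        Real.log_le_log (hpos E₁) h1
    _ = Real.log (∑ ω, Real.exp (E₂ ω)) + D := by
        rw [Real.log_mul (Real.exp_pos D).ne' (hpos E₂).ne', Real.log_exp, add_comm]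

end Elementary

/-! ### The nearest-neighbour graph: `ℓ¹` distance one, ordered adjacent pairs versus edges -/

section Graph

/-- `|-x|₁ = |x|₁`. [folklore] -/
theorem l1Norm_neg (x : Site d) : l1Norm (-x) = l1Norm x := by
  simp [l1Norm, Int.natAbs_neg]

/-- `|x - y|₁ = |y - x|₁`. [folklore] -/
theorem l1Norm_sub_comm (x y : Site d) : l1Norm (x - y) = l1Norm (y - x) := by
  rw [← neg_sub, l1Norm_neg]

/-- `|eᵢ|₁ = 1` for a unit coordinate vector. [folklore] -/
theorem l1Norm_single (i : Fin d) : l1Norm (Pi.single i 1 : Site d) = 1 := by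
  unfold l1Norm
  have h : ∀ j : Fin d, ((Pi.single i 1 : Site d) j).natAbs = if j = i then 1 else 0 := by
    intro j
    by_cases hj : j = i
    · subst hj; simp
    · simp [hj]
  simp_rw [h]
  rw [Finset.sum_ite_eq' univ i, if_pos (Finset.mem_univ _)]

/-- Nearest neighbours of `ℤ^d` are at `ℓ¹` distance `1`. [folklore] -/
theorem l1Norm_sub_eq_one_of_adj {x y : Site d} (h : (zdGraph d).Adj x y) : l1Norm (x - y) = 1 := by
  obtain ⟨i, h | h⟩ := (zdGraph_adj_iff x y).1 h
  · rw [h, sub_add_cancel_left, l1Norm_neg, l1Norm_single]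
  · rw [h, add_sub_cancel_left, l1Norm_single]

/-- A lattice vector of `ℓ¹` norm `1` is `±eᵢ`. [folklore] -/
theorem eq_single_or_of_l1Norm_eq_one {z : Site d} (hz : l1Norm z = 1) :
    ∃ i : Fin d, z = Pi.single i 1 ∨ z = -Pi.single i 1 := by
  have hne : z ≠ 0 := by
    rintro rfl
    simp [l1Norm] at hz
  obtain ⟨i, hi⟩ := Function.ne_iff.1 hne
  have h1 : 1 ≤ (z i).natAbs := Int.natAbs_pos.2 hi
  have hsplit : l1Norm z = (z i).natAbs + ∑ j ∈ univ.erase i, (z j).natAbs := by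
    unfold l1Norm
    exact (Finset.add_sum_erase univ (fun j => (z j).natAbs) (Finset.mem_univ i)).symm
  rw [hz] at hsplit
  have hzi : (z i).natAbs = 1 := by omega
  have hrest : ∑ j ∈ univ.erase i, (z j).natAbs = 0 := by omega
  have hzero : ∀ j, j ≠ i → z j = 0 := fun j hj =>
    Int.natAbs_eq_zero.1 (Finset.sum_eq_zero_iff.1 hrest j (Finset.mem_erase.2 ⟨hj, Finset.mem_univ j⟩))
  refine ⟨i, ?_⟩
  rcases Int.natAbs_eq_iff.1 hzi with h | h
  · left
    funext j
    by_cases hj : j = i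
    · subst hj; simpa using h
    · rw [hzero j hj, Pi.single_eq_of_ne hj]
  · right
    funext j
    by_cases hj : j = i
    · subst hj; simpa using h
    · rw [hzero j hj, Pi.neg_apply, Pi.single_eq_of_ne hj, neg_zero]

/-- Points of `ℤ^d` at `ℓ¹` distance `1` are nearest neighbours. [folklore] -/
theorem adj_of_l1Norm_sub_eq_one {x y : Site d} (h : l1Norm (x - y) = 1) : (zdGraph d).Adj x y := by
  obtain ⟨i, h | h⟩ := eq_single_or_of_l1Norm_eq_one h
  · exact (zdGraph_adj_iff x y).2 ⟨i, Or.inr (by rw [sub_eq_iff_eq_add] at h; rw [h, add_comm])⟩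
  · exact (zdGraph_adj_iff x y).2 ⟨i, Or.inl (by rw [sub_eq_iff_eq_add] at h; rw [h]; abel)⟩

/-- **The nearest-neighbour coupling of the barrier file is the adjacency indicator of `ℤ^d`**:
`𝟙{|x-y|₁ = 1} = 𝟙{x ∼ y}`. [cite: Panis2023Triviality, §1.2.1 (examples: nearest-neighbour interactions)] -/
theorem nnCoupling_eq_ite (x y : Site d) : nnCoupling d x y = if (zdGraph d).Adj x y then 1 else 0 := by
  unfold nnCoupling
  by_cases hadj : (zdGraph d).Adj x y
  · rw [if_pos (l1Norm_sub_eq_one_of_adj hadj), if_pos hadj]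
  · rw [if_neg (fun h => hadj (adj_of_l1Norm_sub_eq_one h)), if_neg hadj]

/-- `𝟙{|x-y|₁ = 1} ≥ 0`. [folklore] -/
theorem nnCoupling_nonneg (x y : Site d) : 0 ≤ nnCoupling d x y := by
  unfold nnCoupling; split_ifs <;> norm_num

/-- A sum over ordered pairs of adjacent vertices of `Λ` is a sum over the edges inside `Λ` of the
symmetrised summand (local copy of the lemma of `MeanFieldDifferentialInequality`, kept out of the
imports of this file). [folklore] -/
theorem sum_adj_eq_sum_edgesIn' {V : Type*} [DecidableEq V] (G : SimpleGraph V) [G.LocallyFinite]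
    [DecidableRel G.Adj] (Λ : Finset V) (f : V → V → ℝ) :
    ∑ x ∈ Λ, ∑ y ∈ Λ.filter (G.Adj x), f x y =
      ∑ e ∈ edgesIn G Λ, Sym2.lift ⟨fun x y => f x y + f y x, fun _ _ => add_comm _ _⟩ e := by
  set D := (Λ ×ˢ Λ).filter (fun p : V × V => G.Adj p.1 p.2) with hD
  have hL : ∑ x ∈ Λ, ∑ y ∈ Λ.filter (G.Adj x), f x y = ∑ p ∈ D, f p.1 p.2 := by
    rw [hD, sum_filter, sum_product]
    refine sum_congr rfl fun x _ => ?_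
    rw [sum_filter]
  have hmaps : ∀ p ∈ D, s(p.1, p.2) ∈ edgesIn G Λ := by
    intro p hp
    rw [hD, mem_filter, mem_product] at hp
    refine mem_edgesIn_iff.2 ⟨(SimpleGraph.mem_edgeSet G).2 hp.2, fun v hv => ?_⟩
    rcases Sym2.mem_iff.1 hv with rfl | rfl
    · exact hp.1.1
    · exact hp.1.2
  rw [hL, ← sum_fiberwise_of_maps_to hmaps]
  refine sum_congr rfl fun e he => ?_
  induction e using Sym2.ind with
  | _ x y =>
    obtain ⟨hadj, hmem⟩ := mem_edgesIn_iff.1 he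
    have hadj' : G.Adj x y := (SimpleGraph.mem_edgeSet G).1 hadj
    have hxy : x ≠ y := G.ne_of_adj hadj'
    have hfib : D.filter (fun p : V × V => s(p.1, p.2) = s(x, y)) = {(x, y), (y, x)} := by
      ext p
      simp only [hD, mem_filter, mem_product, mem_insert, mem_singleton, Sym2.eq_iff]
      constructor
      · rintro ⟨-, ⟨h1, h2⟩ | ⟨h1, h2⟩⟩
        · left; exact Prod.ext h1 h2
        · right; exact Prod.ext h1 h2
      · rintro (rfl | rfl)
        · exact ⟨⟨⟨hmem x (Sym2.mem_mk_left x y), hmem y (Sym2.mem_mk_right x y)⟩, hadj'⟩, Or.inl ⟨rfl, rfl⟩⟩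
        · exact ⟨⟨⟨hmem y (Sym2.mem_mk_right x y), hmem x (Sym2.mem_mk_left x y)⟩, hadj'.symm⟩, Or.inr ⟨rfl, rfl⟩⟩
    rw [hfib, sum_pair (fun h => hxy (Prod.ext_iff.1 h).1), Sym2.lift_mk]

/-- **Pairs versus bonds**: `∑_{x,y∈Λ} 𝟙{|x-y|₁=1} σ_xσ_y = 2 ∑_{e∈ℰ_Λ} σ_e`. [folklore] -/
theorem sum_sum_nnCoupling_eq_two_mul_sum_edgesIn (Λ : Finset (Site d)) (σ : SpinConfig (Site d)) :
    ∑ x ∈ Λ, ∑ y ∈ Λ, nnCoupling d x y * spinAt x σ * spinAt y σ =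
      2 * ∑ e ∈ edgesIn (zdGraph d) Λ, bondSpin σ e := by
  have h1 : ∀ x ∈ Λ, ∑ y ∈ Λ, nnCoupling d x y * spinAt x σ * spinAt y σ =
      ∑ y ∈ Λ.filter ((zdGraph d).Adj x), spinAt x σ * spinAt y σ := by
    intro x _
    rw [Finset.sum_filter]
    refine Finset.sum_congr rfl fun y _ => ?_
    rw [nnCoupling_eq_ite]
    split_ifs <;> simp
  rw [Finset.sum_congr rfl h1, sum_adj_eq_sum_edgesIn' (zdGraph d) Λ, Finset.mul_sum]
  refine Finset.sum_congr rfl fun e _ => ?_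
  induction e using Sym2.ind with
  | _ x y => rw [Sym2.lift_mk, bondSpin_mk]; ring

end Graph

/-! ### The plus and the free Hamiltonians differ by the boundary bonds -/

section Energies

variable (Λ : Finset (Site d)) (C₀ β h : ℝ)

/-- The energy `-βC₀ H⁺_{Λ;h/C₀}` of the tree's nearest-neighbour plus model at inverse temperature
`βC₀` and the energy `-β H_{Λ,C₀1_{∼},h}` of the pair model differ by at most `βC₀|∂ᵉΛ|`
(`β, C₀ ≥ 0`): inside `Λ` the two glued configurations agree, the bonds of `ℰ_Λ` contribute equally
(pairs versus bonds), and each of the `|∂ᵉΛ|` boundary bonds of the plus Hamiltonian is `±1`.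
[cite: FriedliVelenik2017, §3.2.1 (boundary terms are o(|Λ|))] -/
theorem abs_energy_plus_sub_pair_le (hβ : 0 ≤ β) (hC₀ : 0 < C₀) (τ : SpinConfig ↥Λ) :
    |(-(β * C₀) * isingHamiltonian (zdGraph d) Λ (h / C₀) .plus (glue Λ τ .plus)) -
        (-β * pairHamiltonian (fun x y => C₀ * nnCoupling d x y) Λ h (glue Λ τ .free))| ≤
      β * C₀ * #(edgeBoundary (zdGraph d) Λ) := by
  set σp := glue Λ τ .plus with hσp
  set σf := glue Λ τ .free with hσf
  have hin : ∀ x ∈ Λ, spinAt x σp = spinAt x σf := fun x hx => by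
    rw [hσp, hσf, spinAt_glue_of_mem τ .plus hx, spinAt_glue_of_mem τ .free hx]
  -- field terms agree
  have hfield : ∑ x ∈ Λ, spinAt x σp = ∑ x ∈ Λ, spinAt x σf := Finset.sum_congr rfl hin
  -- bonds inside agree
  have hbondsIn : ∑ e ∈ edgesIn (zdGraph d) Λ, bondSpin σp e = ∑ e ∈ edgesIn (zdGraph d) Λ, bondSpin σf e := by
    refine Finset.sum_congr rfl fun e he => ?_
    obtain ⟨-, hmem⟩ := mem_edgesIn_iff.1 he
    induction e using Sym2.ind with
    | _ x y => rw [bondSpin_mk, bondSpin_mk, hin x (hmem x (Sym2.mem_mk_left x y)),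
        hin y (hmem y (Sym2.mem_mk_right x y))]
  -- pair energy in bond form
  have hpair : -β * pairHamiltonian (fun x y => C₀ * nnCoupling d x y) Λ h σf =
      β * C₀ * ∑ e ∈ edgesIn (zdGraph d) Λ, bondSpin σf e + β * h * ∑ x ∈ Λ, spinAt x σf := by
    have h2 := sum_sum_nnCoupling_eq_two_mul_sum_edgesIn Λ σf
    have h3 : ∑ x ∈ Λ, ∑ y ∈ Λ, C₀ * nnCoupling d x y * spinAt x σf * spinAt y σf =
        C₀ * ∑ x ∈ Λ, ∑ y ∈ Λ, nnCoupling d x y * spinAt x σf * spinAt y σf := by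
      rw [Finset.mul_sum]
      refine Finset.sum_congr rfl fun x _ => ?_
      rw [Finset.mul_sum]
      exact Finset.sum_congr rfl fun y _ => by ring
    rw [pairHamiltonian, h3, h2]
    ring
  -- plus energy in bond form, split into inside and boundary bonds
  have hplus : -(β * C₀) * isingHamiltonian (zdGraph d) Λ (h / C₀) .plus σp =
      β * C₀ * ∑ e ∈ edgesIn (zdGraph d) Λ, bondSpin σp e +
        β * C₀ * ∑ e ∈ edgeBoundary (zdGraph d) Λ, bondSpin σp e + β * h * ∑ x ∈ Λ, spinAt x σp := by
    rw [isingHamiltonian, show (BoundaryCondition.plus : BoundaryCondition (Site d)) = .fixed 1 from rfl,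
      interactionEdges_fixed, edgeBoundary,
      ← Finset.sum_sdiff (edgesIn_subset_edgesTouching (G := zdGraph d) Λ)]
    field_simp
    ring
  have hbdry : |∑ e ∈ edgeBoundary (zdGraph d) Λ, bondSpin σp e| ≤ #(edgeBoundary (zdGraph d) Λ) := by
    calc |∑ e ∈ edgeBoundary (zdGraph d) Λ, bondSpin σp e| ≤ ∑ e ∈ edgeBoundary (zdGraph d) Λ, |bondSpin σp e| :=
          Finset.abs_sum_le_sum_abs _ _
      _ ≤ ∑ _e ∈ edgeBoundary (zdGraph d) Λ, (1 : ℝ) := Finset.sum_le_sum fun e _ => by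
          rcases bondSpin_eq_one_or_neg_one σp e with h1 | h1 <;> rw [h1] <;> norm_num
      _ = #(edgeBoundary (zdGraph d) Λ) := by simp
  rw [hplus, hpair, hbondsIn, hfield]
  have h0 : 0 ≤ β * C₀ := mul_nonneg hβ hC₀.le
  calc |β * C₀ * ∑ e ∈ edgesIn (zdGraph d) Λ, bondSpin σf e +
          β * C₀ * ∑ e ∈ edgeBoundary (zdGraph d) Λ, bondSpin σp e + β * h * ∑ x ∈ Λ, spinAt x σf -
        (β * C₀ * ∑ e ∈ edgesIn (zdGraph d) Λ, bondSpin σf e + β * h * ∑ x ∈ Λ, spinAt x σf)|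
      = β * C₀ * |∑ e ∈ edgeBoundary (zdGraph d) Λ, bondSpin σp e| := by
        rw [← abs_of_nonneg h0, ← abs_mul, abs_of_nonneg h0]; ring_nf
    _ ≤ β * C₀ * #(edgeBoundary (zdGraph d) Λ) := mul_le_mul_of_nonneg_left hbdry h0

end Energies

/-! ### The two Jensen bounds and the partition-function comparison -/

section Chain

variable (Λ : Finset (Site d)) (C₀ β h : ℝ)

/-- **Plus side (Griffiths 1964)**: `βh ∑_{x∈Λ} ⟨σ_x⟩⁺_{Λ;βC₀,0} ≤ log Z⁺_Λ(βC₀, h/C₀) - log Z⁺_Λ(βC₀, 0)`.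
[cite: FriedliVelenik2017, §3.2.1 (convexity of the pressure in h)] -/
theorem mul_sum_isingCorr_plus_le_log_sub (hC₀ : C₀ ≠ 0) :
    β * h * ∑ x ∈ Λ, isingCorr (zdGraph d) Λ (β * C₀) 0 .plus {x} ≤
      Real.log (isingPartitionFunction (zdGraph d) Λ (β * C₀) (h / C₀) .plus) -
        Real.log (isingPartitionFunction (zdGraph d) Λ (β * C₀) 0 .plus) := by
  set G := zdGraph d
  set w : SpinConfig ↥Λ → ℝ := fun τ => isingWeight G Λ (β * C₀) 0 .plus τ with hw
  set g : SpinConfig ↥Λ → ℝ := fun τ => β * h * ∑ x ∈ Λ, spinAt x (glue Λ τ .plus) with hg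
  have hwpos : ∀ τ, 0 < w τ := fun τ => isingWeight_pos G Λ _ _ _ τ
  have hJ := sum_mul_div_le_log_sub_log w g hwpos
  -- `Z⁺(h') = ∑ w e^{g}`
  have hZh : isingPartitionFunction G Λ (β * C₀) (h / C₀) .plus = ∑ τ, w τ * Real.exp (g τ) := by
    rw [isingPartitionFunction]
    refine Finset.sum_congr rfl fun τ _ => ?_
    show isingWeight G Λ (β * C₀) (h / C₀) .plus τ =
      isingWeight G Λ (β * C₀) 0 .plus τ * Real.exp (β * h * ∑ x ∈ Λ, spinAt x (glue Λ τ .plus))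
    rw [isingWeight, isingWeight, ← Real.exp_add]
    congr 1
    rw [isingHamiltonian, isingHamiltonian]
    field_simp
    ring
  have hZ0 : isingPartitionFunction G Λ (β * C₀) 0 .plus = ∑ τ, w τ := rfl
  -- `∑ w g / Z⁺(0) = βh ∑_x ⟨σ_x⟩⁺`
  have hnum : (∑ τ, w τ * g τ) / ∑ τ, w τ = β * h * ∑ x ∈ Λ, isingCorr G Λ (β * C₀) 0 .plus {x} := by
    have h1 : ∀ x ∈ Λ, isingCorr G Λ (β * C₀) 0 .plus {x} =
        (∑ τ, w τ * spinAt x (glue Λ τ .plus)) / ∑ τ, w τ := by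
      intro x _
      rw [isingCorr, isingExpect, integral_isingMeasure G Λ _ _ _ (measurable_spinProduct {x}), ← hZ0]
      simp only [spinProduct, Finset.prod_singleton]
      rfl
    have hL : ∑ τ, w τ * g τ = β * h * ∑ x ∈ Λ, ∑ τ, w τ * spinAt x (glue Λ τ .plus) := by
      have h2 : ∀ τ, w τ * g τ = ∑ x ∈ Λ, β * h * (w τ * spinAt x (glue Λ τ .plus)) := fun τ => by
        simp only [hg, Finset.mul_sum]
        exact Finset.sum_congr rfl fun x _ => by ring
      simp_rw [h2]
      rw [Finset.sum_comm, Finset.mul_sum]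
      exact Finset.sum_congr rfl fun x _ => by rw [Finset.mul_sum]
    rw [hL, Finset.sum_congr rfl h1, ← Finset.sum_div, mul_div_assoc]
  rw [hnum, ← hZh, ← hZ0] at hJ
  exact hJ

/-- **Free side (Griffiths 1964)**: `log Z_{Λ,J',h} - log Z_{Λ,J',0} ≤ βh ∑_{x∈Λ} ⟨σ_x⟩_{Λ,J',h,β}`
for any pair interaction `J'`. [cite: FriedliVelenik2017, §3.2.1 (convexity of the pressure in h)] -/
theorem log_pairZ_sub_le (J' : Site d → Site d → ℝ) :
    Real.log (∑ τ : SpinConfig ↥Λ, pairGibbsWeight J' Λ β h τ) -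
        Real.log (∑ τ : SpinConfig ↥Λ, pairGibbsWeight J' Λ β 0 τ) ≤
      β * h * ∑ x ∈ Λ, expectIn J' Λ β h (spinAt x) := by
  set w : SpinConfig ↥Λ → ℝ := fun τ => pairGibbsWeight J' Λ β h τ with hw
  set g : SpinConfig ↥Λ → ℝ := fun τ => -(β * h * ∑ x ∈ Λ, spinAt x (glue Λ τ .free)) with hg
  have hwpos : ∀ τ, 0 < w τ := fun τ => pairGibbsWeight_pos J' Λ β h τ
  have hJ := sum_mul_div_le_log_sub_log w g hwpos
  have hZ0 : ∑ τ : SpinConfig ↥Λ, pairGibbsWeight J' Λ β 0 τ = ∑ τ, w τ * Real.exp (g τ) := by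
    refine Finset.sum_congr rfl fun τ _ => ?_
    show pairGibbsWeight J' Λ β 0 τ =
      pairGibbsWeight J' Λ β h τ * Real.exp (-(β * h * ∑ x ∈ Λ, spinAt x (glue Λ τ .free)))
    rw [pairGibbsWeight, pairGibbsWeight, ← Real.exp_add]
    congr 1
    rw [pairHamiltonian, pairHamiltonian]
    ring
  have hL : ∑ τ, w τ * g τ = -(β * h) * ∑ τ, (∑ x ∈ Λ, spinAt x (glue Λ τ .free)) * pairGibbsWeight J' Λ β h τ := by
    rw [Finset.mul_sum]
    refine Finset.sum_congr rfl fun τ _ => ?_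
    simp only [hw, hg]
    ring
  have hnum : (∑ τ, w τ * g τ) / ∑ τ, w τ = -(β * h * ∑ x ∈ Λ, expectIn J' Λ β h (spinAt x)) := by
    rw [← expectIn_finset_sum, expectIn, hL]
    simp only [hw]
    ring
  rw [hnum, ← hZ0] at hJ
  linarith

/-- **The pressure does not depend on the boundary condition, quantitatively**:
`log Z_{Λ,C₀1_{∼},h,β} ≤ log Z⁺_Λ(βC₀,h/C₀) + βC₀|∂ᵉΛ|` and
`log Z⁺_Λ(βC₀,0) ≤ log Z_{Λ,C₀1_{∼},0,β} + βC₀|∂ᵉΛ|`. [cite: FriedliVelenik2017, §3.2.1 (boundary terms are o(|Λ|))] -/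
theorem log_isingZ_le_and_le (hβ : 0 ≤ β) (hC₀ : 0 < C₀) :
    Real.log (isingPartitionFunction (zdGraph d) Λ (β * C₀) (h / C₀) .plus) ≤
        Real.log (∑ τ : SpinConfig ↥Λ, pairGibbsWeight (fun x y => C₀ * nnCoupling d x y) Λ β h τ) +
          β * C₀ * #(edgeBoundary (zdGraph d) Λ) ∧
      Real.log (∑ τ : SpinConfig ↥Λ, pairGibbsWeight (fun x y => C₀ * nnCoupling d x y) Λ β 0 τ) ≤
        Real.log (isingPartitionFunction (zdGraph d) Λ (β * C₀) 0 .plus) +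
          β * C₀ * #(edgeBoundary (zdGraph d) Λ) := by
  constructor
  · simp only [pairGibbsWeight, isingPartitionFunction, isingWeight]
    refine log_sum_exp_le_of_le fun τ => ?_
    have h1 := abs_energy_plus_sub_pair_le Λ C₀ β h hβ hC₀ τ
    rw [abs_le] at h1
    linarith [h1.2]
  · simp only [pairGibbsWeight, isingPartitionFunction, isingWeight]
    refine log_sum_exp_le_of_le fun τ => ?_
    have h1 := abs_energy_plus_sub_pair_le Λ C₀ β 0 hβ hC₀ τ
    rw [zero_div, abs_le] at h1
    linarith [h1.1]

end Chain

/-! ### Peierls at every site of the box, and the conclusion -/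

section Peierls

/-- **Peierls' bound at every site of the box**: for `d ≥ 2`, `β' ≥ 4`, every `L` and `x ∈ Λ_L`,
`⟨σ_x⟩⁺_{Λ_L;β',0} ≥ ½` (`⟨σ_x⟩⁺_{Λ_L} ≥ ⟨σ_x⟩⁺_{Λ_{L+‖x‖}+x} = ⟨σ₀⟩⁺_{Λ_{L+‖x‖}} ≥ ½` by
antitonicity in the volume, translation covariance and the tree's Peierls estimate at the origin).
[cite: FriedliVelenik2017, Thm. 3.25 (ii) and eq. (3.40)] -/
theorem half_le_isingCorr_plus_box (hd : 2 ≤ d) {β' : ℝ} (hβ' : 4 ≤ β') (L : ℕ) {x : Site d}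
    (hx : x ∈ box d L) : 1 / 2 ≤ isingCorr (zdGraph d) (box d L) β' 0 .plus {x} := by
  have hβ0 : 0 ≤ β' := le_trans (by norm_num) hβ'
  have h1 : isingCorr (zdGraph d) ((box d (L + Site.supNorm x)).map (Site.shift x).toEmbedding) β' 0 .plus {x} ≤
      isingCorr (zdGraph d) (box d L) β' 0 .plus {x} :=
    isingCorr_plus_le_of_subset (zdGraph d) hβ0 le_rfl (Finset.singleton_subset_iff.2 hx)
      (box_subset_map_shift_box L x)
  have h2 : ({0} : Finset (Site d)).map (Site.shift x).toEmbedding = {x} := by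
    rw [Finset.map_singleton]; simp
  have h3 := isingCorr_plus_map_shift x (box d (L + Site.supNorm x)) {0} β' 0
  rw [h2] at h3
  rw [h3] at h1
  exact (half_le_isingCorr_plus_box_zero hd hβ' _).trans h1

/-- **The key finite-volume inequality** (Griffiths' argument in the box `Λ_L`): for `d ≥ 2`,
`J ≥ C₀1_{∼}` translation invariant, `βC₀ ≥ 4`, `h > 0`,
`βh|Λ_L|/2 ≤ βh|Λ_L| ⟨σ₀⟩_{J,h,β} + 2βC₀|∂ᵉΛ_L|`. [cite: Panis2023Triviality, §1.2.1 (β_c < ∞, after Peierls 1936)] -/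
theorem key_box_inequality (hd : 2 ≤ d) {J : Site d → Site d → ℝ} (hJ : ∀ x y, 0 ≤ J x y)
    (hJt : ∀ a x y, J (x + a) (y + a) = J x y) {C₀ : ℝ} (hC₀ : 0 < C₀)
    (hJnn : ∀ x y, (zdGraph d).Adj x y → C₀ ≤ J x y) {β : ℝ} (hβ : 4 ≤ β * C₀) {h : ℝ} (hh : 0 < h) (L : ℕ) :
    β * h * #(box d L) / 2 ≤ β * h * #(box d L) * state J β h (spinAt 0) +
      2 * (β * C₀) * #(edgeBoundary (zdGraph d) (box d L)) := by
  set Λ := box d L with hΛ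
  have hβ0 : 0 ≤ β := by
    by_contra hneg
    have : β * C₀ ≤ 0 := mul_nonpos_of_nonpos_of_nonneg (le_of_not_ge hneg) hC₀.le
    linarith
  have hJ'0 : ∀ x y, 0 ≤ C₀ * nnCoupling d x y := fun x y => mul_nonneg hC₀.le (nnCoupling_nonneg x y)
  have hJ'J : ∀ x y, C₀ * nnCoupling d x y ≤ J x y := by
    intro x y
    rw [nnCoupling_eq_ite]
    split_ifs with hadj
    · rw [mul_one]; exact hJnn x y hadj
    · rw [mul_zero]; exact hJ x y
  -- (1) Peierls summed over the box
  have h1 : β * h * #Λ / 2 ≤ β * h * ∑ x ∈ Λ, isingCorr (zdGraph d) Λ (β * C₀) 0 .plus {x} := by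
    have hs : ∑ _x ∈ Λ, (1 / 2 : ℝ) ≤ ∑ x ∈ Λ, isingCorr (zdGraph d) Λ (β * C₀) 0 .plus {x} :=
      Finset.sum_le_sum fun x hx => half_le_isingCorr_plus_box hd hβ L hx
    rw [Finset.sum_const, nsmul_eq_mul] at hs
    have h0 : 0 ≤ β * h := mul_nonneg hβ0 hh.le
    nlinarith
  -- (2)-(4) Jensen twice and the boundary comparison
  have h2 := mul_sum_isingCorr_plus_le_log_sub Λ C₀ β h hC₀.ne'
  obtain ⟨h3a, h3b⟩ := log_isingZ_le_and_le Λ C₀ β h hβ0 hC₀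
  have h4 := log_pairZ_sub_le Λ β h (fun x y => C₀ * nnCoupling d x y)
  -- (5) `⟨σ_x⟩_{Λ,J',h,β} ≤ ⟨σ₀⟩_{J,h,β}`
  have h5 : ∑ x ∈ Λ, expectIn (fun x y => C₀ * nnCoupling d x y) Λ β h (spinAt x) ≤ #Λ * state J β h (spinAt 0) := by
    have hle : ∀ x ∈ Λ, expectIn (fun x y => C₀ * nnCoupling d x y) Λ β h (spinAt x) ≤ state J β h (spinAt 0) := by
      intro x hx
      rw [← state_spinAt_eq_state_spinAt_zero J β h hβ0 hh.le hJ hJt x, ← spinProduct_singleton_eq_spinAt]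
      calc expectIn (fun x y => C₀ * nnCoupling d x y) Λ β h (spinProduct {x}) ≤ expectIn J Λ β h (spinProduct {x}) :=
            expectIn_spinProduct_mono_coupling J Λ β h hβ0 hh.le
              (fun x y => by rw [abs_of_nonneg (hJ'0 x y)]; exact hJ'J x y) {x}
        _ ≤ state J β h (spinProduct {x}) :=
            expectIn_le_state_field J β h hβ0 hh.le hJ (Finset.singleton_subset_iff.2 hx)
    calc ∑ x ∈ Λ, expectIn (fun x y => C₀ * nnCoupling d x y) Λ β h (spinAt x)
        ≤ ∑ _x ∈ Λ, state J β h (spinAt 0) := Finset.sum_le_sum hle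
      _ = #Λ * state J β h (spinAt 0) := by rw [Finset.sum_const, nsmul_eq_mul]
  have h0 : 0 ≤ β * h := mul_nonneg hβ0 hh.le
  have h6 := mul_le_mul_of_nonneg_left h5 h0
  linarith [h1, h2, h3a, h3b, h4, h6]

/-- **`⟨σ₀⟩_{J,h,β} ≥ ½` for all `h > 0`** when `d ≥ 2`, `J ≥ 0` is translation invariant with
`J_{x,y} ≥ C₀ > 0` on nearest neighbours and `βC₀ ≥ 4` (divide the key inequality by `βh|Λ_L|`
and let `L → ∞`, `|∂ᵉΛ_L|/|Λ_L| → 0`). [cite: Panis2023Triviality, §1.2.1 (β_c < ∞, after Peierls 1936)] -/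
theorem half_le_state_spinAt (hd : 2 ≤ d) {J : Site d → Site d → ℝ} (hJ : ∀ x y, 0 ≤ J x y)
    (hJt : ∀ a x y, J (x + a) (y + a) = J x y) {C₀ : ℝ} (hC₀ : 0 < C₀)
    (hJnn : ∀ x y, (zdGraph d).Adj x y → C₀ ≤ J x y) {β : ℝ} (hβ : 4 ≤ β * C₀) {h : ℝ} (hh : 0 < h) :
    1 / 2 ≤ state J β h (spinAt 0) := by
  have hβC : 0 < β * C₀ := lt_of_lt_of_le (by norm_num) hβ
  have hβ0 : 0 < β := pos_of_mul_pos_left hβC hC₀.le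
  have ht : 0 < β * h := mul_pos hβ0 hh
  refine le_of_forall_pos_le_add fun ε hε => ?_
  -- choose `L` with `2βC₀|∂ᵉΛ_L| ≤ ε βh |Λ_L|`
  set δ : ℝ := ε * (β * h) / (2 * (β * C₀)) with hδ
  have hδpos : 0 < δ := by positivity
  obtain ⟨L, hL⟩ := (eventually_card_edgeBoundary_box_le (d := d) hδpos).exists
  have hkey := key_box_inequality hd hJ hJt hC₀ hJnn hβ hh L
  have hcard : (0 : ℝ) < #(box d L) := by exact_mod_cast Finset.card_pos.2 (box_nonempty d L)
  have hA : 0 < β * h * #(box d L) := mul_pos ht hcard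
  have hbd : 2 * (β * C₀) * #(edgeBoundary (zdGraph d) (box d L)) ≤ ε * (β * h * #(box d L)) := by
    calc 2 * (β * C₀) * #(edgeBoundary (zdGraph d) (box d L)) ≤ 2 * (β * C₀) * (δ * #(box d L)) :=
          mul_le_mul_of_nonneg_left hL (by positivity)
      _ = ε * (β * h * #(box d L)) := by rw [hδ]; field_simp
  have h2 : β * h * #(box d L) * (1 / 2) ≤ β * h * #(box d L) * (state J β h (spinAt 0) + ε) := by
    nlinarith [hkey, hbd]
  exact le_of_mul_le_mul_left h2 hA

/-- **`m*(β) ≥ ½` for `βC₀ ≥ 4`** (`d ≥ 2`, `J ≥ 0` translation invariant, `J ≥ C₀ > 0` on nearest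
neighbours): the long-range models of Panis's Theorem 1.2 are ordered at low temperature, i.e.
`β_c ≤ 4/C₀ < ∞`. [cite: Panis2023Triviality, §1.2.1 (β_c < ∞, after Peierls 1936)] -/
theorem half_le_magnetization (hd : 2 ≤ d) {J : Site d → Site d → ℝ} (hJ : ∀ x y, 0 ≤ J x y)
    (hJt : ∀ a x y, J (x + a) (y + a) = J x y) {C₀ : ℝ} (hC₀ : 0 < C₀)
    (hJnn : ∀ x y, (zdGraph d).Adj x y → C₀ ≤ J x y) {β : ℝ} (hβ : 4 ≤ β * C₀) :
    1 / 2 ≤ magnetization J β := by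
  have hβC : 0 < β * C₀ := lt_of_lt_of_le (by norm_num) hβ
  have hβ0 : 0 < β := pos_of_mul_pos_left hβC hC₀.le
  exact le_magnetization_of_forall_le J β hβ0.le hJ one_pos fun h hh _ =>
    half_le_state_spinAt hd hJ hJt hC₀ hJnn hβ hh

end Peierls

end LongRangeIsing

end Literature.Barriers.CriticalPhenomena
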